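import Summits.QuantumFields.YangMills.Theorems.UnitScaleTiltProp7RLegsLinTowerRowsOfRegPr
import Summits.QuantumFields.YangMills.Theorems.UnitScaleTiltProp7RLegsCovKnit
import HarnessLib

/-!
# Route `UnitScaleTilt`, crux K1 «MinimiserStabilityRegPr» (stmt-QuantumFields-19200), LANE II (R-LEGS) — file F-9d-d «THE LINEAR-RESPONSE ROWS ON `T³`, VERBATIM, AND THE CURVED ROW»:
# (hG)∕(hN′) of ✓p718441 `Prop7RLegsCovKnit.covGradLegs_of_linTower_rows` and (hG♭)∕(hN♭) of ✓p721143 `Prop7RLegsCovKnitB.covGradLegs_of_linTower_rowsB` as THEOREMS, hence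
# the curved (R-LEGS) row `rlegs` and (R-LEGS-cov) `hCov` at every printed-regular member, unconditionally

Cell `ym3-torus`, width seat `ym3-torus-px18` (gen 5); pen F-9d ≡ F-8′ (★routeR-w1 g10; ★routeR-w2 g10; w4-20520 g12∕g13 SPEC #58∕#59 and the two knits).  THEOREMS ONLY (0 `def`,
0 `sorry`); `--supports stmt-QuantumFields-19200 --as helper`, count-neutral.  YM₃ on T³ is a ladder rung (R3), not the Clay problem; nothing here claims (QB), (QH1), `hEng`,
`hMcomb`, (β), hN06, the stub, the crux, d = 4 or the mass gap.

THE POINT.  ✓F-9d-c `Prop7RLegsLinTowerRowsOfRegPr.linTower_rows_master` proves both rows of `Y_l = D[Ũˡ(W♯,(eᵗᴬ)♯)]·A` with the `l`-SHARP window `e²·L^{3l}·ℓ⁻⁴·SA`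
(`ℓ = L^{K−n}`).  ★★★ `linTower_grad_row`∕`linTower_mass_row` are its projections onto ✓p718441's hypothesis texts (hG)∕(hN′) VERBATIM; since `L^{3l}·ℓ⁻⁴ ≤ Lˡ·ℓ⁻²` for
`l ≤ K − n` (`flat_dom`), ★★★ `linTower_grad_rowB`∕`linTower_mass_rowB` are ✓p721143's (hG♭)∕(hN♭) VERBATIM.  Feeding the first pair to ✓p718441's knit:
★★★ `covGradLegs_of_regPr : ⟨✓p707999 `rlegs_of_covGradLegs`'s hypothesis `hCov`⟩` and ★★★ `rlegs_of_regPr : ⟨the curved (R-LEGS) row `rlegs` = ✓p718441∕✓p721143's common conclusion⟩`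
— LANE II's curved-legs row at every printed-regular member, from `RegPr` alone.  All statement texts copied BY SCRIPT from the TREE files
`Theorems/UnitScaleTiltProp7RLegsCovKnit.lean` (`covGradLegs_of_linTower_rows`, `rlegs_of_linTower_rows`) and `Theorems/UnitScaleTiltProp7RLegsCovKnitB.lean`.
HONEST SCOPE.  Projections + one monotonicity; the analysis is ✓F-9a∕F-9d-a∕b∕c and ★routeR's comb tower.  [Balaban1985Variational] (2), (106)–(111) p.294, (146) p.301;
[Balaban1985Averaging] (110)–(112) p.34, (160)–(163) p.42; [Balaban1987RG1] (0.1)–(0.4) pp.251–253.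
-/

set_option autoImplicit false

noncomputable section

open scoped BigOperators Matrix.Norms.L2Operator Matrix

namespace Summit.QuantumFields.YangMills.Theorems.Prop7RLegsLinTowerRowsT3

open Finset
open Literature.MathematicalPhysics.QuantumFieldTheory.Balaban1983to89
open Literature.MathematicalPhysics.QuantumFieldTheory.Balaban1983to89.T3ContinuumYM3Torus
open Literature.MathematicalPhysics.QuantumFieldTheory.Balaban1983to89.T3PrintedRegularMinimiser (RegPr)
open T4Continuum BlockAveraging AveragingRT ExpMeanLog
open T3LevelShift (bondShift)
open T3PrintedRegularOrbits (sites_eq)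
open T3SectALandauChart (bgUnits)
open B7Prop1Explicit renaming Site → LSite
open B7Prop1Explicit (e expUnit)
open B7Prop2Explicit (avgIter)
open B7Eq92Concrete (tildIter)
open B7Eq78Linearization (conjR)
open B10Eq27TorusAxialLog (pull unitsField toUField)
open B9Eq39Adjoint (curl divB)
open B9TorusCalculus (torusT)
open Summit.QuantumFields.YangMills.Theorems.Prop7SPrint (basePt)
open Summit.QuantumFields.YangMills.Theorems.Prop7SymAvgTw (frameTw)
open Summit.QuantumFields.YangMills.Theorems.Prop7RLegsLinTowerRowsOfRegPr (linTower_rows_master)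
open Summit.QuantumFields.YangMills.Theorems.Prop7RLegsCovKnit (covGradLegs_of_linTower_rows rlegs_of_linTower_rows)

/-! ## §1 The `l`-sharp rows (✓p718441's (hG)∕(hN′) VERBATIM) -/

/-- ★★★ **(hG) — THE GRADIENT ROW OF THE LINEAR-RESPONSE TOWER, PER COARSE DIRECTION** — hypothesis `hG` of ✓`Prop7RLegsCovKnit.covGradLegs_of_linTower_rows` ∕
`rlegs_of_linTower_rows` VERBATIM, now a theorem: projected from ✓`linTower_rows_master` (`CG := 4 + 192·wG·r`, `CG' := CW`, `eG := (4·10⁷L³)⁻¹`).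
[cite: Balaban1985Variational, (2), (106)-(111) p.294; Balaban1987RG1, (0.4) p.253] -/
theorem linTower_grad_row :
    ∀ (L : ℕ), 1 < L → ∃ CG CG' eG : ℝ, 0 ≤ CG ∧ 0 ≤ CG' ∧ 0 < eG ∧
      ∀ (F : T3Family), F.L = L → ∀ (n K : ℕ) (hnK : n < K) (e : ℝ) (W : GaugeField (F.P K) 0 (Matrix.specialUnitaryGroup (Fin 2) ℂ)),
        0 < e → e ≤ eG → RegPr F n K e W → ∀ (A : PBond (F.P K) 0 → Matrix (Fin 2) (Fin 2) ℂ) (l : ℕ), l < K - n → ∀ μ : Fin (F.P K).d,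
        ∑ x : Site (F.P K) l, ∑ κ : Fin (F.P K).d,
          ‖fderiv ℂ (fun t : PBond (F.P K) 0 → Matrix (Fin 2) (Fin 2) ℂ =>
                ((tildIter (F.P K).L (pull (bgUnits F K W) (basePt F n K)) (pull (fun b => expUnit (t b)) (basePt F n K)) l (fun ν => ((x ν).val : ℤ)) κ :
                  (Matrix (Fin 2) (Fin 2) ℂ)ˣ) : Matrix (Fin 2) (Fin 2) ℂ)) 0 A
            - conjR (avgIter (F.P K).L (pull (bgUnits F K W) (basePt F n K)) l (fun ν => ((x ν).val : ℤ)) μ)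
              (fderiv ℂ (fun t : PBond (F.P K) 0 → Matrix (Fin 2) (Fin 2) ℂ =>
                ((tildIter (F.P K).L (pull (bgUnits F K W) (basePt F n K)) (pull (fun b => expUnit (t b)) (basePt F n K)) l ((fun ν => ((x ν).val : ℤ)) + B7Prop1Explicit.e μ) κ :
                  (Matrix (Fin 2) (Fin 2) ℂ)ˣ) : Matrix (Fin 2) (Fin 2) ℂ)) 0 A)‖ ^ 2
          ≤ CG * (F.L : ℝ) ^ l * (∑ b : PBond (F.P K) 0, ∑ ν : Fin (F.P K).d,
                ‖((W ⟨b.src, ν⟩ : Matrix.specialUnitaryGroup (Fin 2) ℂ) : Matrix (Fin 2) (Fin 2) ℂ) * A ⟨b.src.shift ν, b.dir⟩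
                    * star ((W ⟨b.src, ν⟩ : Matrix.specialUnitaryGroup (Fin 2) ℂ) : Matrix (Fin 2) (Fin 2) ℂ) - A b‖ ^ 2)
            + CG' * e ^ 2 * (F.L : ℝ) ^ (3 * l) * (((F.L : ℝ) ^ (K - n)) ^ 4)⁻¹ * ∑ b : PBond (F.P K) 0, ‖A b‖ ^ 2 := by
  intro L hL
  obtain ⟨CN, CN', CW, CG, eR, -, -, hCW, hCG, heR, h⟩ := linTower_rows_master L hL
  exact ⟨CG, CW, eR, hCG, hCW, heR, fun F hF n K hnK e W he heR' hreg A l hl μ => (h F hF n K hnK e W he heR' hreg A l hl).2 μ⟩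

/-- ★★★ **(hN′) — THE MASS ROW OF THE LINEAR-RESPONSE TOWER** — hypothesis `hN` of ✓`Prop7RLegsCovKnit.covGradLegs_of_linTower_rows` ∕ `rlegs_of_linTower_rows` VERBATIM, now a
theorem: projected from ✓`linTower_rows_master` (`CN := 2·ER²`, `CN' := 16·wG·r`, `CN'' := CW`, `eN := (4·10⁷L³)⁻¹`).  Its `L^{−l}·SA` slot is the one the knit cannot do without
(★routeR-w2's pure-gauge bump). [cite: Balaban1985Variational, (2), (106)-(111) p.294; Balaban1985Averaging, Prop. 3 (122)-(126)] -/
theorem linTower_mass_row :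
    ∀ (L : ℕ), 1 < L → ∃ CN CN' CN'' eN : ℝ, 0 ≤ CN ∧ 0 ≤ CN' ∧ 0 ≤ CN'' ∧ 0 < eN ∧
      ∀ (F : T3Family), F.L = L → ∀ (n K : ℕ) (hnK : n < K) (e : ℝ) (W : GaugeField (F.P K) 0 (Matrix.specialUnitaryGroup (Fin 2) ℂ)),
        0 < e → e ≤ eN → RegPr F n K e W → ∀ (A : PBond (F.P K) 0 → Matrix (Fin 2) (Fin 2) ℂ) (l : ℕ), l < K - n →
        ∑ x : Site (F.P K) l, ∑ κ : Fin (F.P K).d,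
          ‖fderiv ℂ (fun t : PBond (F.P K) 0 → Matrix (Fin 2) (Fin 2) ℂ =>
                ((tildIter (F.P K).L (pull (bgUnits F K W) (basePt F n K)) (pull (fun b => expUnit (t b)) (basePt F n K)) l (fun ν => ((x ν).val : ℤ)) κ :
                  (Matrix (Fin 2) (Fin 2) ℂ)ˣ) : Matrix (Fin 2) (Fin 2) ℂ)) 0 A‖ ^ 2
          ≤ CN * ((F.L : ℝ) ^ l)⁻¹ * ∑ b : PBond (F.P K) 0, ‖A b‖ ^ 2
            + CN' * (F.L : ℝ) ^ l * (∑ b : PBond (F.P K) 0, ∑ ν : Fin (F.P K).d,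
                ‖((W ⟨b.src, ν⟩ : Matrix.specialUnitaryGroup (Fin 2) ℂ) : Matrix (Fin 2) (Fin 2) ℂ) * A ⟨b.src.shift ν, b.dir⟩
                    * star ((W ⟨b.src, ν⟩ : Matrix.specialUnitaryGroup (Fin 2) ℂ) : Matrix (Fin 2) (Fin 2) ℂ) - A b‖ ^ 2)
            + CN'' * e ^ 2 * (F.L : ℝ) ^ (3 * l) * (((F.L : ℝ) ^ (K - n)) ^ 4)⁻¹ * ∑ b : PBond (F.P K) 0, ‖A b‖ ^ 2 := by
  intro L hL
  obtain ⟨CN, CN', CW, CG, eR, hCN, hCN', hCW, -, heR, h⟩ := linTower_rows_master L hL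
  exact ⟨CN, CN', CW, eR, hCN, hCN', hCW, heR, fun F hF n K hnK e W he heR' hreg A l hl => (h F hF n K hnK e W he heR' hreg A l hl).1⟩

/-! ## §2 The `ℓ⁻²`-anchored rows (✓p721143's (hG♭)∕(hN♭) VERBATIM) -/

/-- `L^{3l}·((Lᵏ)⁴)⁻¹ ≤ Lˡ·((Lᵏ)²)⁻¹` for `1 ≤ L`, `l ≤ k` (the `l`-sharp window dominates the `ℓ⁻²`-anchored one). -/
theorem flat_dom {L : ℝ} (hL : 1 ≤ L) {l k : ℕ} (hl : l ≤ k) : L ^ (3 * l) * ((L ^ k) ^ 4)⁻¹ ≤ L ^ l * ((L ^ k) ^ 2)⁻¹ := by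
  have hL0 : 0 < L := by linarith
  have hk : 0 < (L ^ k) ^ 2 := by positivity
  have h2 : L ^ (2 * l) ≤ (L ^ k) ^ 2 := by
    rw [← pow_mul, mul_comm k 2]; exact pow_le_pow_right₀ hL (by omega)
  have e1 : L ^ (3 * l) * ((L ^ k) ^ 4)⁻¹ = (L ^ l * ((L ^ k) ^ 2)⁻¹) * (L ^ (2 * l) * ((L ^ k) ^ 2)⁻¹) := by
    rw [show (L ^ k) ^ 4 = (L ^ k) ^ 2 * (L ^ k) ^ 2 by ring, mul_inv, show 3 * l = l + 2 * l by ring, pow_add]; ring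
  rw [e1]
  have h3 : L ^ (2 * l) * ((L ^ k) ^ 2)⁻¹ ≤ 1 := by rw [mul_inv_le_iff₀ hk, one_mul]; exact h2
  exact mul_le_of_le_one_right (by positivity) h3

/-- ★★★ **(hG♭) — THE GRADIENT ROW WITH THE `ℓ⁻²`-ANCHORED WINDOW** — hypothesis `hG` of ✓`Prop7RLegsCovKnitB.covGradLegs_of_linTower_rowsB` ∕ `rlegs_of_linTower_rowsB`
VERBATIM: from `linTower_grad_row` by `flat_dom`. [cite: Balaban1985Variational, (2), (106)-(111) p.294; Balaban1987RG1, (0.4) p.253] -/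
theorem linTower_grad_rowB :
    ∀ (L : ℕ), 1 < L → ∃ CG CG' eG : ℝ, 0 ≤ CG ∧ 0 ≤ CG' ∧ 0 < eG ∧
      ∀ (F : T3Family), F.L = L → ∀ (n K : ℕ) (hnK : n < K) (e : ℝ) (W : GaugeField (F.P K) 0 (Matrix.specialUnitaryGroup (Fin 2) ℂ)),
        0 < e → e ≤ eG → RegPr F n K e W → ∀ (A : PBond (F.P K) 0 → Matrix (Fin 2) (Fin 2) ℂ) (l : ℕ), l < K - n → ∀ μ : Fin (F.P K).d,
        ∑ x : Site (F.P K) l, ∑ κ : Fin (F.P K).d,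
          ‖fderiv ℂ (fun t : PBond (F.P K) 0 → Matrix (Fin 2) (Fin 2) ℂ =>
                ((tildIter (F.P K).L (pull (bgUnits F K W) (basePt F n K)) (pull (fun b => expUnit (t b)) (basePt F n K)) l (fun ν => ((x ν).val : ℤ)) κ :
                  (Matrix (Fin 2) (Fin 2) ℂ)ˣ) : Matrix (Fin 2) (Fin 2) ℂ)) 0 A
            - conjR (avgIter (F.P K).L (pull (bgUnits F K W) (basePt F n K)) l (fun ν => ((x ν).val : ℤ)) μ)
              (fderiv ℂ (fun t : PBond (F.P K) 0 → Matrix (Fin 2) (Fin 2) ℂ =>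
                ((tildIter (F.P K).L (pull (bgUnits F K W) (basePt F n K)) (pull (fun b => expUnit (t b)) (basePt F n K)) l ((fun ν => ((x ν).val : ℤ)) + B7Prop1Explicit.e μ) κ :
                  (Matrix (Fin 2) (Fin 2) ℂ)ˣ) : Matrix (Fin 2) (Fin 2) ℂ)) 0 A)‖ ^ 2
          ≤ CG * (F.L : ℝ) ^ l * (∑ b : PBond (F.P K) 0, ∑ ν : Fin (F.P K).d,
                ‖((W ⟨b.src, ν⟩ : Matrix.specialUnitaryGroup (Fin 2) ℂ) : Matrix (Fin 2) (Fin 2) ℂ) * A ⟨b.src.shift ν, b.dir⟩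
                    * star ((W ⟨b.src, ν⟩ : Matrix.specialUnitaryGroup (Fin 2) ℂ) : Matrix (Fin 2) (Fin 2) ℂ) - A b‖ ^ 2)
            + CG' * e ^ 2 * (F.L : ℝ) ^ l * (((F.L : ℝ) ^ (K - n)) ^ 2)⁻¹ * ∑ b : PBond (F.P K) 0, ‖A b‖ ^ 2 := by
  intro L hL
  obtain ⟨CG, CG', eG, hCG, hCG', heG, h⟩ := linTower_grad_row L hL
  refine ⟨CG, CG', eG, hCG, hCG', heG, fun F hF n K hnK e W he heG' hreg A l hl μ => (h F hF n K hnK e W he heG' hreg A l hl μ).trans ?_⟩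
  have hL1 : (1 : ℝ) ≤ (F.L : ℝ) := by rw [show (F.L : ℝ) = (L : ℝ) by exact_mod_cast hF]; exact_mod_cast hL.le
  have hd := flat_dom hL1 hl.le
  have hS : 0 ≤ ∑ b : PBond (F.P K) 0, ‖A b‖ ^ 2 := Finset.sum_nonneg fun _ _ => sq_nonneg _
  have hx : CG' * e ^ 2 * (F.L : ℝ) ^ (3 * l) * (((F.L : ℝ) ^ (K - n)) ^ 4)⁻¹ ≤ CG' * e ^ 2 * (F.L : ℝ) ^ l * (((F.L : ℝ) ^ (K - n)) ^ 2)⁻¹ := by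
    rw [mul_assoc (CG' * e ^ 2), mul_assoc (CG' * e ^ 2)]; exact mul_le_mul_of_nonneg_left hd (by positivity)
  exact add_le_add le_rfl (mul_le_mul_of_nonneg_right hx hS)

/-- ★★★ **(hN♭) — THE MASS ROW WITH THE `ℓ⁻²`-ANCHORED WINDOW** — hypothesis `hN` of ✓`Prop7RLegsCovKnitB.covGradLegs_of_linTower_rowsB` ∕ `rlegs_of_linTower_rowsB` VERBATIM:
from `linTower_mass_row` by `flat_dom`. [cite: Balaban1985Variational, (2), (106)-(111) p.294; Balaban1985Averaging, Prop. 3 (122)-(126)] -/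
theorem linTower_mass_rowB :
    ∀ (L : ℕ), 1 < L → ∃ CN CN' CN'' eN : ℝ, 0 ≤ CN ∧ 0 ≤ CN' ∧ 0 ≤ CN'' ∧ 0 < eN ∧
      ∀ (F : T3Family), F.L = L → ∀ (n K : ℕ) (hnK : n < K) (e : ℝ) (W : GaugeField (F.P K) 0 (Matrix.specialUnitaryGroup (Fin 2) ℂ)),
        0 < e → e ≤ eN → RegPr F n K e W → ∀ (A : PBond (F.P K) 0 → Matrix (Fin 2) (Fin 2) ℂ) (l : ℕ), l < K - n →
        ∑ x : Site (F.P K) l, ∑ κ : Fin (F.P K).d,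
          ‖fderiv ℂ (fun t : PBond (F.P K) 0 → Matrix (Fin 2) (Fin 2) ℂ =>
                ((tildIter (F.P K).L (pull (bgUnits F K W) (basePt F n K)) (pull (fun b => expUnit (t b)) (basePt F n K)) l (fun ν => ((x ν).val : ℤ)) κ :
                  (Matrix (Fin 2) (Fin 2) ℂ)ˣ) : Matrix (Fin 2) (Fin 2) ℂ)) 0 A‖ ^ 2
          ≤ CN * ((F.L : ℝ) ^ l)⁻¹ * ∑ b : PBond (F.P K) 0, ‖A b‖ ^ 2
            + CN' * (F.L : ℝ) ^ l * (∑ b : PBond (F.P K) 0, ∑ ν : Fin (F.P K).d,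
                ‖((W ⟨b.src, ν⟩ : Matrix.specialUnitaryGroup (Fin 2) ℂ) : Matrix (Fin 2) (Fin 2) ℂ) * A ⟨b.src.shift ν, b.dir⟩
                    * star ((W ⟨b.src, ν⟩ : Matrix.specialUnitaryGroup (Fin 2) ℂ) : Matrix (Fin 2) (Fin 2) ℂ) - A b‖ ^ 2)
            + CN'' * e ^ 2 * (F.L : ℝ) ^ l * (((F.L : ℝ) ^ (K - n)) ^ 2)⁻¹ * ∑ b : PBond (F.P K) 0, ‖A b‖ ^ 2 := by
  intro L hL
  obtain ⟨CN, CN', CN'', eN, hCN, hCN', hCN'', heN, h⟩ := linTower_mass_row L hL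
  refine ⟨CN, CN', CN'', eN, hCN, hCN', hCN'', heN, fun F hF n K hnK e W he heN' hreg A l hl => (h F hF n K hnK e W he heN' hreg A l hl).trans ?_⟩
  have hL1 : (1 : ℝ) ≤ (F.L : ℝ) := by rw [show (F.L : ℝ) = (L : ℝ) by exact_mod_cast hF]; exact_mod_cast hL.le
  have hd := flat_dom hL1 hl.le
  have hS : 0 ≤ ∑ b : PBond (F.P K) 0, ‖A b‖ ^ 2 := Finset.sum_nonneg fun _ _ => sq_nonneg _
  have hx : CN'' * e ^ 2 * (F.L : ℝ) ^ (3 * l) * (((F.L : ℝ) ^ (K - n)) ^ 4)⁻¹ ≤ CN'' * e ^ 2 * (F.L : ℝ) ^ l * (((F.L : ℝ) ^ (K - n)) ^ 2)⁻¹ := by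
    rw [mul_assoc (CN'' * e ^ 2), mul_assoc (CN'' * e ^ 2)]; exact mul_le_mul_of_nonneg_left hd (by positivity)
  exact add_le_add le_rfl (mul_le_mul_of_nonneg_right hx hS)

/-! ## §3 ★★★ The curved (R-LEGS) row at every printed-regular member -/

/-- ★★★ **(R-LEGS-cov) AT EVERY PRINTED-REGULAR MEMBER** — ✓p707999 `Prop7RLegsOfCovGrad.rlegs_of_covGradLegs`'s hypothesis `hCov` (= ✓`covGradLegs_of_linTower_rows`'s conclusion)
VERBATIM, unconditionally: the knit ✓p718441 fed with `linTower_grad_row`, `linTower_mass_row`. [cite: Balaban1985Averaging, (110)-(112) p.34, (160)-(163) p.42;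
Balaban1985Variational, (146) p.301] -/
theorem covGradLegs_of_regPr :
    ∀ (L : ℕ), 1 < L → ∃ Cr Cr' er : ℝ, 0 ≤ Cr ∧ 0 ≤ Cr' ∧ 0 < er ∧
      ∀ (F : T3Family), F.L = L → ∀ (n K : ℕ) (hnK : n < K) (e : ℝ) (W : GaugeField (F.P K) 0 (Matrix.specialUnitaryGroup (Fin 2) ℂ)),
        0 < e → e ≤ er → RegPr F n K e W → ∀ (A : PBond (F.P K) 0 → Matrix (Fin 2) (Fin 2) ℂ),
        ∑ c : PBond (F.P n) 0,
          ‖fderiv ℂ (fun A : PBond (F.P K) 0 → Matrix (Fin 2) (Fin 2) ℂ => ((frameTw F n K hnK.le W A c.src : (Matrix (Fin 2) (Fin 2) ℂ)ˣ) : Matrix (Fin 2) (Fin 2) ℂ)) 0 A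
              - ((Averaging.iter (fun i => blockAvg (P := F.P K) (j := i) (expMeanLogSU (n := Fin 2))) (K - n) W (bondShift (sites_eq F n K hnK.le) c) :
                  Matrix.specialUnitaryGroup (Fin 2) ℂ) : Matrix (Fin 2) (Fin 2) ℂ)
                * fderiv ℂ (fun A : PBond (F.P K) 0 → Matrix (Fin 2) (Fin 2) ℂ => ((frameTw F n K hnK.le W A c.tgt : (Matrix (Fin 2) (Fin 2) ℂ)ˣ) : Matrix (Fin 2) (Fin 2) ℂ)) 0 A
                * star ((Averaging.iter (fun i => blockAvg (P := F.P K) (j := i) (expMeanLogSU (n := Fin 2))) (K - n) W (bondShift (sites_eq F n K hnK.le) c) :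
                  Matrix.specialUnitaryGroup (Fin 2) ℂ) : Matrix (Fin 2) (Fin 2) ℂ)‖ ^ 2
          ≤ Cr * (F.L : ℝ) ^ (K - n) * (∑ b : PBond (F.P K) 0, ∑ ν : Fin (F.P K).d,
                ‖((W ⟨b.src, ν⟩ : Matrix.specialUnitaryGroup (Fin 2) ℂ) : Matrix (Fin 2) (Fin 2) ℂ) * A ⟨b.src.shift ν, b.dir⟩
                    * star ((W ⟨b.src, ν⟩ : Matrix.specialUnitaryGroup (Fin 2) ℂ) : Matrix (Fin 2) (Fin 2) ℂ) - A b‖ ^ 2)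
            + Cr' * e * ((F.L : ℝ) ^ (K - n))⁻¹ * ∑ b : PBond (F.P K) 0, ‖A b‖ ^ 2 :=
  covGradLegs_of_linTower_rows linTower_grad_row linTower_mass_row

/-- ★★★ **THE CURVED (R-LEGS) ROW `rlegs` AT EVERY PRINTED-REGULAR MEMBER** — the common conclusion of ✓`Prop7RLegsCovKnit.rlegs_of_linTower_rows` and
✓`Prop7RLegsCovKnitB.rlegs_of_linTower_rowsB` (= px19 K2's `hR`, px21 FILE 3's `hR`) VERBATIM, unconditionally. [cite: Balaban1985Averaging, (110)-(112) p.34, (160)-(163) p.42;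
Balaban1985Variational, (6) p.278, (146) p.301; Balaban1987RG1, (0.1)-(0.4) pp.251-253] -/
theorem rlegs_of_regPr :
    ∀ (L : ℕ), 1 < L → ∃ Cr Cr' er : ℝ, 0 ≤ Cr ∧ 0 ≤ Cr' ∧ 0 < er ∧
    ∀ (F : T3Family), F.L = L → ∀ (n K : ℕ) (hnK : n < K) (e : ℝ) (W : GaugeField (F.P K) 0 (Matrix.specialUnitaryGroup (Fin 2) ℂ)),
      0 < e → e ≤ er → RegPr F n K e W → ∀ (A : PBond (F.P K) 0 → Matrix (Fin 2) (Fin 2) ℂ),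
      ∑ c : PBond (F.P n) 0,
        ‖fderiv ℂ (fun A : PBond (F.P K) 0 → Matrix (Fin 2) (Fin 2) ℂ => ((frameTw F n K hnK.le W A c.src : (Matrix (Fin 2) (Fin 2) ℂ)ˣ) : Matrix (Fin 2) (Fin 2) ℂ)) 0 A
            - ((Averaging.iter (fun i => blockAvg (P := F.P K) (j := i) (expMeanLogSU (n := Fin 2))) (K - n) W (bondShift (sites_eq F n K hnK.le) c) :
                Matrix.specialUnitaryGroup (Fin 2) ℂ) : Matrix (Fin 2) (Fin 2) ℂ)
              * fderiv ℂ (fun A : PBond (F.P K) 0 → Matrix (Fin 2) (Fin 2) ℂ => ((frameTw F n K hnK.le W A c.tgt : (Matrix (Fin 2) (Fin 2) ℂ)ˣ) : Matrix (Fin 2) (Fin 2) ℂ)) 0 A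
              * star ((Averaging.iter (fun i => blockAvg (P := F.P K) (j := i) (expMeanLogSU (n := Fin 2))) (K - n) W (bondShift (sites_eq F n K hnK.le) c) :
                Matrix.specialUnitaryGroup (Fin 2) ℂ) : Matrix (Fin 2) (Fin 2) ℂ)‖ ^ 2
        ≤ Cr * (F.L : ℝ) ^ (K - n) * ((∑ x : Site (F.P K) 0, ∑ μ : Fin (F.P K).d, ∑ ν : Fin (F.P K).d,
              (if μ < ν then ∑ j : Fin 2, ∑ k : Fin 2,
                ‖(curl (torusT (F.P K) 0) (fun κ z => unitsField (toUField W) ⟨z, κ⟩) (fun κ z => A ⟨z, κ⟩) μ ν x) j k‖ ^ 2 else 0))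
            + (∑ x : Site (F.P K) 0, ∑ j : Fin 2, ∑ k : Fin 2,
              ‖(divB (torusT (F.P K) 0) (fun κ z => unitsField (toUField W) ⟨z, κ⟩) (fun κ z => A ⟨z, κ⟩) x) j k‖ ^ 2))
          + Cr' * e * ((F.L : ℝ) ^ (K - n))⁻¹ * ∑ b : PBond (F.P K) 0, ‖A b‖ ^ 2 :=
  rlegs_of_linTower_rows linTower_grad_row linTower_mass_row

end Summit.QuantumFields.YangMills.Theorems.Prop7RLegsLinTowerRowsT3

end
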